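import Literature.Geometry.Symplectic.PALFKasCount
import Literature.Geometry.Symplectic.PlanarHomologySphereFillingsCancel
import HarnessLib

/-!
# Oba 2016: the Kas count reduced to a Morse function on the planar page

Topic `Literature/Geometry/Symplectic` (fact seat
`provefact-Literature.Geometry.Symplectic.Oba2016_s-add47373d4`).  With Kas' theorem
`PALF.hasHandleDecomposition_of_fibreMorse` (`PALFKasCount.lean`) proved, the handle count `hK` of
`Oba2016_steinFilling_fourHoledSphere_of_wendl_of_kas_of_kasIncidence` — a planar PALF with
`n + 1` binding components gives a handle decomposition with `(1, n, #crit f, 0, …)` handles — is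
reduced to the surface-topological statement `hF` below: *on the interior `F°` of the regular
fibre over a regular value `c₀` — of norm below a bound `ρ' > 0` of the prover's choosing — of a
planar PALF with `n + 1` binding components there is, for every admissible collar level, a Morse
function with the collar profile having exactly one minimum, `n` saddles and no maximum* (Kas 1980, §2: the page is a sphere with `n + 1` holes; Oba 2016, §2.2).  Both
theorems here are proved implications; `hF`, Wendl's theorem `hW` and Kas' incidences `hI`
remain hypotheses (no named facts are introduced, D-0026).

* `kasHandleCount_of_planarFibreMorse` — `hF → hK`;
* `Oba2016_steinFilling_fourHoledSphere_of_wendl_of_planarFibreMorse_of_kasIncidence` —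
  `hW → hF → hI → Oba2016_steinFilling_fourHoledSphere`.

## References

* T. Oba, *Stein fillings of homology 3-spheres and mapping class groups*, Geom. Dedicata 183
  (2016), Thm. 1.1, §2.2, §3.2. [Oba2016]
* A. Kas, *On the handlebody decomposition associated to a Lefschetz fibration*, Pacific J.
  Math. 89 (1980), §2. [Kas1980]
* C. Wendl, *Strongly fillable contact manifolds and J-holomorphic foliations*, Duke Math. J.
  151 (2010), Thm. 1. [Wendl2010]
-/

open scoped Manifold ContDiff Topology
open Set Function Filter

noncomputable section

namespace Literature.Geometry.Symplectic

open Literature.Topology.FourManifolds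

/-- **Kas' count for planar PALFs, from a Morse function on the planar page** (Kas 1980, §2;
Oba 2016, §2.2): if the interior of the regular fibre of every planar PALF with `n + 1`
binding components carries, for all admissible collar data, a Morse function with the collar
profile and critical counts `(1, n, 0)`, then every such PALF has a handle decomposition with
`(1, n, #crit f, 0, …)` handles (`PALF.hasHandleDecomposition_of_fibreMorse`; indices `≥ 3` do
not occur on a surface, `Literature.Topology.FourManifolds.morseIndex_le_finrank`). [cite: Kas1980, §2] [cite: Oba2016, §2.2 (p. 5)] -/
theorem kasHandleCount_of_planarFibreMorse
    (hF : ∀ (W : Type) [TopologicalSpace W] [T2Space W] [SecondCountableTopology W]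
      [ChartedSpace (EuclideanHalfSpace 4) W] [IsManifold (𝓡∂ 4) ∞ W] [CompactSpace W]
      [ConnectedSpace W] (o : SmoothOrientation (𝓡∂ 4) W) (b : BoundaryData (𝓡∂ 4) W (𝓡 3))
      (P : PALF o b) (n : ℕ), P.ob.IsPlanar →
      Nat.card (ConnectedComponents P.ob.binding) = n + 1 →
      ∃ ρ' : ℝ, 0 < ρ' ∧ ∀ (D : FlowoutInput 3 W) (c₀ : EuclideanSpace ℝ (Fin 2))
        (hc : c₀ ∉ P.f '' ↑P.crit) (c s₁ : ℝ), ‖c₀‖ < ρ' → 0 < c → 2 * c < s₁ →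
        (∀ q : RegularFibreOn (P.isRegularFibreOn_interior hc),
          D.f (RegularFibreOn.incl (P.isRegularFibreOn_interior hc) q) < s₁ →
            ¬ IsMCriticalPt (𝓡 2)
              (fun q : RegularFibreOn (P.isRegularFibreOn_interior hc) =>
                D.f (RegularFibreOn.incl (P.isRegularFibreOn_interior hc) q)) q) →
        ∃ (bb : ℝ → ℝ) (m : RegularFibreOn (P.isRegularFibreOn_interior hc) → ℝ),
          ContDiff ℝ ∞ bb ∧ (∀ t, 2 * c ≤ t → bb t = bb (2 * c)) ∧
          (∀ t, t < 2 * c → deriv bb t < 0) ∧ IsMorse (𝓡 2) m ∧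
          (∀ q, D.f (RegularFibreOn.incl (P.isRegularFibreOn_interior hc) q) ≤ c →
            m q = bb (D.f (RegularFibreOn.incl (P.isRegularFibreOn_interior hc) q))) ∧
          (∀ q, IsMCriticalPt (𝓡 2) m q →
            3 * c / 2 < D.f (RegularFibreOn.incl (P.isRegularFibreOn_interior hc) q)) ∧
          (criticalSetOfIndex (𝓡 2) m 0).ncard = 1 ∧ (criticalSetOfIndex (𝓡 2) m 1).ncard = n ∧
          (criticalSetOfIndex (𝓡 2) m 2).ncard = 0) :
    ∀ (W : Type) [TopologicalSpace W] [T2Space W] [SecondCountableTopology W]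
      [ChartedSpace (EuclideanHalfSpace 4) W] [IsManifold (𝓡∂ 4) ∞ W] [CompactSpace W]
      [ConnectedSpace W] (o : SmoothOrientation (𝓡∂ 4) W) (b : BoundaryData (𝓡∂ 4) W (𝓡 3))
      (P : PALF o b) (n : ℕ), P.ob.IsPlanar →
      Nat.card (ConnectedComponents P.ob.binding) = n + 1 →
      HasHandleDecomposition 3 W
        (fun k => if k = 0 then 1 else if k = 1 then n else if k = 2 then P.crit.card else 0) := by
  intro W _ _ _ _ _ _ _ o b P n hpl hcard
  obtain ⟨ρ', hρ', hF'⟩ := hF W o b P n hpl hcard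
  obtain ⟨D, c₀, hc, c, s₁, hc₀, hc0, hcs, hreg, hmain⟩ := P.hasHandleDecomposition_of_fibreMorse hρ'
  obtain ⟨bb, m, hbb, hbb_const, hbb', hm, hmcol, hmcrit, h0, h1, h2⟩ :=
    hF' D c₀ hc c s₁ hc₀ hc0 hcs hreg
  have h := hmain bb hbb hbb_const hbb' m hm hmcol hmcrit
  have hfun : (fun k => (criticalSetOfIndex (𝓡 2) m k).ncard + if k = 2 then P.crit.card else 0) =
      fun k => if k = 0 then 1 else if k = 1 then n else if k = 2 then P.crit.card else 0 := by
    funext k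
    rcases Nat.lt_or_ge k 3 with hk | hk
    · interval_cases k <;> simp [h0, h1, h2]
    · have hempty : criticalSetOfIndex (𝓡 2) m k = ∅ := by
        ext q
        simp only [criticalSetOfIndex, mem_setOf_eq, mem_empty_iff_false, iff_false, not_and]
        intro _ hidx
        have hle := morseIndex_le_finrank (𝓡 2) m q
        rw [finrank_euclideanSpace_fin] at hle
        omega
      have hk0 : k ≠ 0 := by omega
      have hk1 : k ≠ 1 := by omega
      have hk2 : k ≠ 2 := by omega
      simp [hempty, hk0, hk1, hk2]
  rw [hfun] at h
  exact h

/-- **Oba 2016, Theorem 1.1 (four-holed sphere), reduced to Wendl's theorem, a Morse function on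
the planar page and Kas' incidences** — `Oba2016_steinFilling_fourHoledSphere_of_wendl_of_kas_of_kasIncidence`
with its handle-count hypothesis `hK` discharged by Kas' theorem
(`PALF.hasHandleDecomposition_of_fibreMorse`) modulo the surface statement `hF` of
`kasHandleCount_of_planarFibreMorse`. [cite: Oba2016, Thm. 1.1 and its proof (§3.2, p. 8), §2.2 (p. 5)]
[cite: Wendl2010, Thm. 1] [cite: Kas1980, §2] -/
theorem Oba2016_steinFilling_fourHoledSphere_of_wendl_of_planarFibreMorse_of_kasIncidence
    (hW : ∀ (W : Type) [TopologicalSpace W] [T2Space W] [SecondCountableTopology W]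
      [ChartedSpace (EuclideanHalfSpace 4) W] [IsManifold (𝓡∂ 4) ∞ W] [CompactSpace W]
      [ConnectedSpace W] (S : SteinStructure W) (b : BoundaryData (𝓡∂ 4) W (𝓡 3))
      (K : OpenBook b.carrier), K.IsPlanar → K.Supports (boundaryPlaneField S.J b) →
      ∃ P : PALF S.complexOrientation b, P.ob.IsPlanar ∧ Nonempty (P.ob.binding ≃ₜ K.binding))
    (hF : ∀ (W : Type) [TopologicalSpace W] [T2Space W] [SecondCountableTopology W]
      [ChartedSpace (EuclideanHalfSpace 4) W] [IsManifold (𝓡∂ 4) ∞ W] [CompactSpace W]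
      [ConnectedSpace W] (o : SmoothOrientation (𝓡∂ 4) W) (b : BoundaryData (𝓡∂ 4) W (𝓡 3))
      (P : PALF o b) (n : ℕ), P.ob.IsPlanar →
      Nat.card (ConnectedComponents P.ob.binding) = n + 1 →
      ∃ ρ' : ℝ, 0 < ρ' ∧ ∀ (D : FlowoutInput 3 W) (c₀ : EuclideanSpace ℝ (Fin 2))
        (hc : c₀ ∉ P.f '' ↑P.crit) (c s₁ : ℝ), ‖c₀‖ < ρ' → 0 < c → 2 * c < s₁ →
        (∀ q : RegularFibreOn (P.isRegularFibreOn_interior hc),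
          D.f (RegularFibreOn.incl (P.isRegularFibreOn_interior hc) q) < s₁ →
            ¬ IsMCriticalPt (𝓡 2)
              (fun q : RegularFibreOn (P.isRegularFibreOn_interior hc) =>
                D.f (RegularFibreOn.incl (P.isRegularFibreOn_interior hc) q)) q) →
        ∃ (bb : ℝ → ℝ) (m : RegularFibreOn (P.isRegularFibreOn_interior hc) → ℝ),
          ContDiff ℝ ∞ bb ∧ (∀ t, 2 * c ≤ t → bb t = bb (2 * c)) ∧
          (∀ t, t < 2 * c → deriv bb t < 0) ∧ IsMorse (𝓡 2) m ∧
          (∀ q, D.f (RegularFibreOn.incl (P.isRegularFibreOn_interior hc) q) ≤ c →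
            m q = bb (D.f (RegularFibreOn.incl (P.isRegularFibreOn_interior hc) q))) ∧
          (∀ q, IsMCriticalPt (𝓡 2) m q →
            3 * c / 2 < D.f (RegularFibreOn.incl (P.isRegularFibreOn_interior hc) q)) ∧
          (criticalSetOfIndex (𝓡 2) m 0).ncard = 1 ∧ (criticalSetOfIndex (𝓡 2) m 1).ncard = n ∧
          (criticalSetOfIndex (𝓡 2) m 2).ncard = 0)
    (hI : ∀ (W : Type) [TopologicalSpace W] [T2Space W] [SecondCountableTopology W]
      [ChartedSpace (EuclideanHalfSpace 4) W] [IsManifold (𝓡∂ 4) ∞ W] [CompactSpace W]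
      [ContractibleSpace W] (S : SteinStructure W) (b : BoundaryData (𝓡∂ 4) W (𝓡 3))
      (P : PALF S.complexOrientation b) (n : ℕ), P.ob.IsPlanar →
      Nat.card (ConnectedComponents P.ob.binding) = n + 1 → 2 ≤ n → n ≤ 3 →
      ∃ (g : W → ℝ) (ξ : Cₛ^∞⟮𝓡∂ 4; EuclideanSpace ℝ (Fin 4), (TangentSpace (𝓡∂ 4) : W → Type)⟯)
        (a₀ a₁ a₂ a₃ c c' : ℝ) (p p' r r' x₀ y₀ : W),
        (Cobordism.ofBoundary 3 W).IsMorseFunction g ∧ IsGradientLike (𝓡∂ 4) g ξ ∧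
        (∀ z, IsMCriticalPt (𝓡∂ 4) g z → morseIndex (𝓡∂ 4) g z ≤ 2) ∧
        (criticalSetOfIndex (𝓡∂ 4) g 1).ncard ≤ n ∧
        0 < a₀ ∧ a₁ < a₂ ∧ a₃ < 1 ∧
        p ∈ criticalSetOfIndex (𝓡∂ 4) g 1 ∧ p' ∈ criticalSetOfIndex (𝓡∂ 4) g 2 ∧
        a₀ < g p ∧ g p < c ∧ c < g p' ∧ g p' < a₁ ∧
        (∀ z ∈ criticalSet (𝓡∂ 4) g, g z ∈ Icc a₀ a₁ → z = p ∨ z = p') ∧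
        rightHandSphere (𝓡∂ 4) g ξ p c ∩ leftHandSphere (𝓡∂ 4) g ξ p' c = {x₀} ∧
        IsTransverseInLevel (𝓡∂ 4) (g ⁻¹' {c}) (rightHandSphere (𝓡∂ 4) g ξ p c)
          (leftHandSphere (𝓡∂ 4) g ξ p' c) x₀ ∧
        r ∈ criticalSetOfIndex (𝓡∂ 4) g 1 ∧ r' ∈ criticalSetOfIndex (𝓡∂ 4) g 2 ∧
        a₂ < g r ∧ g r < c' ∧ c' < g r' ∧ g r' < a₃ ∧
        (∀ z ∈ criticalSet (𝓡∂ 4) g, g z ∈ Icc a₂ a₃ → z = r ∨ z = r') ∧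
        rightHandSphere (𝓡∂ 4) g ξ r c' ∩ leftHandSphere (𝓡∂ 4) g ξ r' c' = {y₀} ∧
        IsTransverseInLevel (𝓡∂ 4) (g ⁻¹' {c'}) (rightHandSphere (𝓡∂ 4) g ξ r c')
          (leftHandSphere (𝓡∂ 4) g ξ r' c') y₀) :
    Oba2016_steinFilling_fourHoledSphere :=
  Oba2016_steinFilling_fourHoledSphere_of_wendl_of_kas_of_kasIncidence hW
    (kasHandleCount_of_planarFibreMorse hF) hI

end Literature.Geometry.Symplectic

end
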